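import Literature.Computability.AlgebraicComplexity.BurgisserBooleanParts
import Literature.Computability.AlgebraicComplexity.ValiantCriterion
import Literature.Computability.AlgebraicComplexity.VNPClosedUnderSum
import HarnessLib

/-!
# Valiant's criterion in `#P` form: generating families of Boolean parts are p-definable

The tree's `ValiantCriterion.lean` proves Bürgisser's Prop. 2.20 for `0/1`-valued coefficient
functions in `P/poly` (`isVNPFamily_circuitSum`), and `BurgisserBooleanParts.lean` proves that the
certificate-counting function of a `P`-verifier is a *Boolean part* of a `VNP` family
(`isVNPFamily_countPoly`, `eval_countPoly`). This file supplies the missing bridge and the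
resulting counting form of Valiant's criterion (Bürgisser 2000, Prop. 2.20 for coefficient
functions in `#P`: "if `φ : {0,1}* → ℕ` is in `#P/poly` then the family `(∑_e φ(e) X^e)` is
p-definable"):

* `ValiantCriterion.genPoly F = ∑_{e ∈ {0,1}^m} F(e) · ∏_{t : e_t = 1} X_t` — the multilinear
  generating polynomial of the Boolean part `e ↦ F(e)` of `F`;
* `isVNPFamily_genPoly` — **if `(F_n) ∈ VNP` then `(genPoly F_n) ∈ VNP`** over every commutative
  ring: with `F_n = ∑_y G_n(X, y)`, `G ∈ VP`, the witness is `G_n` with its input variables moved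
  into the Boolean block times the monomial selector (`genWitness`; the computation
  `boolSum_genWitness` is that of `ValiantCriterion.boolSum_witness` with `G_n` in place of the
  transcript arithmetisation);
* `isVNPFamily_certCountGen` — **for every `L' ∈ P` and every polynomial certificate bound `p`,
  the family `(∑_{e ∈ {0,1}ⁿ} #{y : |y| ≤ p(n), ⟨e, y⟩ ∈ L'} · X^e)_n` is in `VNP`** (Valiant 1979;
  Bürgisser 2000, Prop. 2.20), from `isVNPFamily_countPoly` + `eval_countPoly` + the bridge;
* `isVNPFamily_gapCertCountGen` — the `GapP` form: differences of two such certificate counts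
  (coefficient functions in `GapP = #P - #P`) also give `VNP` families (`IsVNPFamily.sub`).

## References

* L. G. Valiant, *Completeness classes in algebra*, STOC 1979, §4.
* P. Bürgisser, *Completeness and Reduction in Algebraic Complexity Theory*, Springer 2000,
  Prop. 2.20 and its proof.
-/

noncomputable section

open MvPolynomial Literature.Computability.Complexity Literature.Computability.Complexity.Classes
  Literature.Computability.AlgebraicComplexity

universe u

namespace Literature.Computability.AlgebraicComplexity

open CircuitArith BoolGadgets

namespace ValiantCriterion

variable {k : Type u} [CommRing k]

/-- The multilinear generating polynomial of the Boolean part of `F`: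
`∑_{e ∈ {0,1}^m} F(e) · ∏_{t : e_t = 1} X_t`. [cite: Burgisser2000, Prop. 2.20] -/
def genPoly {m : ℕ} (F : MvPolynomial (Fin m) k) : MvPolynomial (Fin m) k :=
  ∑ e : Fin m → Bool, C (eval (boolPoint k e) F) * ∏ t : Fin m, (if e t then X t else 1)

/-- Relocation of the variables of the `VP` witness `G`: inputs and Boolean-sum variables both go
to the Boolean block `Fin (m + u)`. [cite: Burgisser2000, proof of Prop. 2.20] -/
def relocG (m u : ℕ) : Fin m ⊕ Fin u → Fin m ⊕ Fin (m + u) :=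
  fun v => Sum.inr (finSumFinEquiv v)

/-- **The `VP` witness** for `genPoly (boolSum G)`: `G` on the Boolean block times the selector
`∏_t (e_t X_t + 1 - e_t)`. [cite: Burgisser2000, proof of Prop. 2.20] -/
def genWitness {m u : ℕ} (G : MvPolynomial (Fin m ⊕ Fin u) k) :
    MvPolynomial (Fin m ⊕ Fin (m + u)) k :=
  rename (relocG m u) G *
    selProd (fun t : Fin m => X (Sum.inr (Fin.castAdd u t))) (fun t => X (Sum.inl t))

/-- The Boolean point `bpt` is the concatenation of two `boolPoint`s. [folklore] -/
private theorem bpt_eq_sumElim {m u : ℕ} (e : Fin m → Bool) (y : Fin u → Bool) :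
    (bpt k e y : Fin m ⊕ Fin u → k) = Sum.elim (boolPoint k e) (boolPoint k y) := by
  funext v
  rcases v with i | j
  · simp only [bpt, Sum.elim_inl, Function.comp_apply, toK, boolPoint_apply]
  · simp only [bpt, Sum.elim_inr, Function.comp_apply, toK, boolPoint_apply]

/-- **The Boolean sum of the witness is the generating polynomial of the Boolean part**:
`∑_{(e,y)} G(e, y) · ∏_{e_t = 1} X_t = ∑_e (∑_y G(e, y)) X^e`. [cite: Burgisser2000, Prop. 2.20] -/
theorem boolSum_genWitness {m u : ℕ} (G : MvPolynomial (Fin m ⊕ Fin u) k) :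
    boolSum (genWitness G) = genPoly (boolSum G) := by
  classical
  unfold boolSum genWitness genPoly
  -- the summand at a Boolean assignment `c = (e, y)`
  have hterm : ∀ c : Fin (m + u) → Bool,
      aeval (Sum.elim X fun j => if c j then (1 : MvPolynomial (Fin m) k) else 0)
        (rename (relocG m u) G *
          selProd (fun t : Fin m => X (Sum.inr (Fin.castAdd u t))) (fun t => X (Sum.inl t))) =
      C (eval (bpt k (splitC c).1 (splitC c).2) G) *
        ∏ t : Fin m, (if (splitC c).1 t then X t else 1) := by
    intro c
    rw [map_mul]
    congr 1
    · rw [aeval_rename]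
      have hφ : ((Sum.elim X fun j => if c j then (1 : MvPolynomial (Fin m) k) else 0) ∘ relocG m u) =
          fun v => C (bpt k (splitC c).1 (splitC c).2 v) := by
        funext v
        cases v with
        | inl i =>
          simp only [Function.comp_apply, relocG, finSumFinEquiv_apply_left, Sum.elim_inr, bpt, splitC,
            Sum.elim_inl]
          cases c (Fin.castAdd u i) <;> simp [toK]
        | inr j =>
          simp only [Function.comp_apply, relocG, finSumFinEquiv_apply_right, Sum.elim_inr, bpt, splitC]
          cases c (Fin.natAdd m j) <;> simp [toK]
      rw [hφ]
      exact aeval_C_comp _ _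
    · rw [aeval_selProd _ _ _ (splitC c).1]
      · refine Finset.prod_congr rfl fun t _ => ?_
        rw [aeval_X]; rfl
      · intro t
        simp only [aeval_X, Sum.elim_inr, splitC, MvPolynomial.algebraMap_eq]
        cases c (Fin.castAdd u t) <;> simp [toK]
  simp only [hterm]
  -- sum over `c` = sum over `(e, y)`
  have hsplit : ∀ Φ : (Fin m → Bool) → (Fin u → Bool) → MvPolynomial (Fin m) k,
      ∑ c : Fin (m + u) → Bool, Φ (splitC c).1 (splitC c).2 =
        ∑ e : Fin m → Bool, ∑ y : Fin u → Bool, Φ e y := by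
    intro Φ
    rw [← Fintype.sum_prod_type']
    refine Fintype.sum_equiv ((Equiv.sumArrowEquivProdArrow _ _ _).symm.trans
      (Equiv.arrowCongr finSumFinEquiv (Equiv.refl Bool))).symm _ _ fun c => ?_
    congr
  rw [hsplit fun e y => C (eval (bpt k e y) G) * ∏ t : Fin m, (if e t then X t else 1)]
  refine Finset.sum_congr rfl fun e _ => ?_
  rw [← Finset.sum_mul, ← map_sum]
  congr 2
  -- `∑_y G(e, y) = (boolSum G)(e)`
  rw [show (∑ x : Fin u → Bool, aeval (Sum.elim X fun j => if x j then (1 : MvPolynomial (Fin m) k)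
      else 0) G) = boolSum G from rfl, eval_boolSum]
  refine Finset.sum_congr rfl fun y _ => ?_
  rw [bpt_eq_sumElim]

/-- The witness has `L ≤ L(G) + 5m + 1`. [cite: Burgisser2000, Prop. 2.20 (g ∈ VP)] -/
theorem complexity_genWitness_le {m u : ℕ} (G : MvPolynomial (Fin m ⊕ Fin u) k) :
    complexity (genWitness G) ≤ complexity G + 5 * m + 1 := by
  unfold genWitness
  have h1 := complexity_rename_le_holds' (k := k) (relocG m u) G
  have h2 : complexity (selProd (fun t : Fin m =>
      (X (Sum.inr (Fin.castAdd u t)) : MvPolynomial (Fin m ⊕ Fin (m + u)) k))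
      (fun t => X (Sum.inl t))) ≤ 5 * m := by
    refine (complexity_selProd_le _ _).trans (le_of_eq ?_)
    rw [Finset.sum_eq_zero fun t _ => by rw [complexity_X_holds, complexity_X_holds]; rfl, zero_add]
  have h3 := complexity_mul_le_holds (rename (relocG m u) G)
    (selProd (fun t : Fin m => (X (Sum.inr (Fin.castAdd u t)) : MvPolynomial (Fin m ⊕ Fin (m + u)) k))
      (fun t => X (Sum.inl t)))
  omega

/-- The witness has degree `≤ deg G + 2m`. [folklore] -/
private theorem totalDegree_genWitness_le {m u : ℕ} (G : MvPolynomial (Fin m ⊕ Fin u) k) :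
    (genWitness G).totalDegree ≤ G.totalDegree + 2 * m := by
  unfold genWitness
  refine (totalDegree_mul _ _).trans (Nat.add_le_add (totalDegree_rename_le _ _) ?_)
  refine (totalDegree_selProd_le _ _).trans ?_
  calc ∑ t : Fin m, ((X (Sum.inr (Fin.castAdd u t)) : MvPolynomial (Fin m ⊕ Fin (m + u)) k).totalDegree +
        (X (Sum.inl t) : MvPolynomial (Fin m ⊕ Fin (m + u)) k).totalDegree)
      ≤ ∑ _t : Fin m, 2 := Finset.sum_le_sum fun t _ =>
        Nat.add_le_add (totalDegree_X_le_one' (k := k) _) (totalDegree_X_le_one' (k := k) _)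
    _ = 2 * m := by simp [mul_comm]

/-- `genPoly F` has degree `≤ m`. [folklore] -/
private theorem totalDegree_genPoly_le {m : ℕ} (F : MvPolynomial (Fin m) k) :
    (genPoly F).totalDegree ≤ m := by
  unfold genPoly
  refine (totalDegree_finsetSum _ _).trans (Finset.sup_le fun e _ => ?_)
  refine (totalDegree_mul _ _).trans ?_
  rw [totalDegree_C, zero_add]
  refine (totalDegree_finsetProd _ _).trans ?_
  calc ∑ t : Fin m, (if e t then (X t : MvPolynomial (Fin m) k) else 1).totalDegree ≤ ∑ _t : Fin m, 1 :=
        Finset.sum_le_sum fun t _ => by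
          split_ifs
          · exact totalDegree_X_le_one' (k := k) _
          · rw [totalDegree_one]; exact Nat.zero_le _
    _ = m := by simp

end ValiantCriterion

open ValiantCriterion

/-- **Generating families of Boolean parts of `VNP` families are in `VNP`** (the bridge inside
Valiant's criterion; Bürgisser 2000, proof of Prop. 2.20): if `(F_n)_n ∈ VNP` with `F_n` in the
variables `X_1, …, X_{m(n)}`, then `(∑_{e ∈ {0,1}^{m(n)}} F_n(e) X^e)_n ∈ VNP`, over every
commutative ring. [cite: Burgisser2000, Prop. 2.20] -/
theorem isVNPFamily_genPoly {k : Type u} [CommRing k] {m : ℕ → ℕ}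
    {F : ∀ n, MvPolynomial (Fin (m n)) k} (hF : IsVNPFamily (σ := fun n => Fin (m n)) F) :
    IsVNPFamily (σ := fun n => Fin (m n)) (fun n => genPoly (F n)) := by
  obtain ⟨⟨hcard, _⟩, u, G, ⟨⟨hGcard, hGdeg⟩, hGcomp⟩, hFG⟩ := hF
  have hm : IsPBounded m := by simpa using hcard
  have hu : IsPBounded u := by
    have h : (fun n => Fintype.card (Fin (m n) ⊕ Fin (u n))) = fun n => m n + u n := by
      funext n; simp
    rw [h] at hGcard
    exact hGcard.mono fun n => Nat.le_add_left _ _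
  refine ⟨⟨hcard, hm.mono fun n => totalDegree_genPoly_le (F n)⟩, fun n => m n + u n,
    fun n => genWitness (G n), ⟨⟨?_, ?_⟩, ?_⟩, fun n => ?_⟩
  · have h : (fun n => Fintype.card (Fin (m n) ⊕ Fin (m n + u n))) = fun n => m n + (m n + u n) := by
      funext n; simp
    rw [h]
    exact IsPBounded.add_holds hm (IsPBounded.add_holds hm hu)
  · exact (IsPBounded.add_holds hGdeg (IsPBounded.mul_holds (IsPBounded.const 2) hm)).mono
      fun n => totalDegree_genWitness_le (G n)
  · exact (IsPBounded.add_holds (IsPBounded.add_holds hGcomp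
      (IsPBounded.mul_holds (IsPBounded.const 5) hm)) (IsPBounded.const 1)).mono
      fun n => complexity_genWitness_le (G n)
  · show genPoly (F n) = boolSum (genWitness (G n))
    rw [hFG n, boolSum_genWitness]

/-- Monotonicity of evaluation of `ℕ`-polynomials (private copy of the tree's
`Literature.Computability.Complexity.natPoly_eval_mono`, not imported here). [folklore] -/
private theorem natPoly_eval_mono'' (q : Polynomial ℕ) {a b : ℕ} (h : a ≤ b) :
    q.eval a ≤ q.eval b := by
  rw [Polynomial.eval_eq_sum_range, Polynomial.eval_eq_sum_range]
  exact Finset.sum_le_sum fun i _ => Nat.mul_le_mul_left _ (Nat.pow_le_pow_left h i)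

/-- **Valiant's criterion, counting form** (Valiant 1979; Bürgisser 2000, Prop. 2.20 for a
coefficient function in `#P`): for every `L' ∈ P` and every polynomial certificate bound `p`, the
family of multilinear polynomials
`(∑_{e ∈ {0,1}ⁿ} #{y : |y| ≤ p(n), ⟨e, y⟩ ∈ L'} · ∏_{e_t = 1} X_t)_n` (coefficient function =
the `#P` function `certCount` of the verifier `L'`) is in `VNP` over every commutative ring.
[cite: Burgisser2000, Prop. 2.20] -/
theorem isVNPFamily_certCountGen {k : Type u} [CommRing k] {L' : Language Bool} (hL' : L' ∈ P)
    (p : Polynomial ℕ) :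
    IsVNPFamily (σ := fun n => Fin n) (fun n => ∑ e : Fin n → Bool,
      C ((certCount (fun n => p.eval n) L' n e : ℕ) : k) * ∏ t : Fin n, (if e t then X t else 1)) := by
  obtain ⟨q, hq⟩ := exists_cktSize_boolPair_of_mem_PPoly (P_subset_PPoly_holds hL')
  simp only [CktSize] at hq
  choose gs out hlen hR using hq
  set pf : ℕ → ℕ := fun n => p.eval n with hpf_def
  set U : ℕ → ℕ := fun n => pf n + ((2 * n + 2 + pf n) + q.eval (2 * n + 2 + pf n)) with hU_def
  have hpf : IsPBounded pf := (isPBounded_iff_exists_polynomial_holds pf).2 ⟨p, fun n => le_rfl⟩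
  have hU : IsPBounded U := by
    refine (isPBounded_iff_exists_polynomial_holds U).2
      ⟨p + ((2 * Polynomial.X + 2 + p) + q.comp (2 * Polynomial.X + 2 + p)), fun n => le_of_eq ?_⟩
    simp [hU_def, hpf_def]
  have hs : ∀ n m, m ≤ pf n → pf n + (gs n m).length ≤ U n := by
    intro n m hm
    have h1 := hlen n m
    have h2 : q.eval (2 * n + 2 + m) ≤ q.eval (2 * n + 2 + pf n) := natPoly_eval_mono'' q (by omega)
    simp only [hU_def]
    omega
  have hB : ∀ n m, ∀ g ∈ gs n m, g.arity ≤ 2 := fun n m g hg => (hR n m).isOver g hg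
  have hF := isVNPFamily_genPoly (m := fun n => n) (F := countPoly (k := k) pf U gs out)
    (isVNPFamily_countPoly (k := k) (out := out) hB hs hpf hU)
  have key : (fun n => genPoly (countPoly (k := k) pf U gs out n)) = fun n => ∑ e : Fin n → Bool,
      C ((certCount pf L' n e : ℕ) : k) * ∏ t : Fin n, (if e t then X t else 1) := by
    funext n
    unfold genPoly
    refine Finset.sum_congr rfl fun e _ => ?_
    rw [eval_countPoly hR hs n e]
  rw [key] at hF
  exact hF

/-- **Valiant's criterion, `GapP` form**: for `L₁, L₂ ∈ P` and polynomial certificate bounds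
`p₁, p₂`, the family with INTEGER coefficient function
`e ↦ #{y : |y| ≤ p₁(n), ⟨e,y⟩ ∈ L₁} - #{y : |y| ≤ p₂(n), ⟨e,y⟩ ∈ L₂}` (a `GapP` function) is in `VNP`
over every commutative ring (Bürgisser 2000, Prop. 2.20 with the closure of `VNP` under
differences). [cite: Burgisser2000, Prop. 2.20] -/
theorem isVNPFamily_gapCertCountGen {k : Type u} [CommRing k] {L₁ L₂ : Language Bool}
    (hL₁ : L₁ ∈ P) (hL₂ : L₂ ∈ P) (p₁ p₂ : Polynomial ℕ) :
    IsVNPFamily (σ := fun n => Fin n) (fun n => ∑ e : Fin n → Bool,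
      C (((certCount (fun n => p₁.eval n) L₁ n e : ℕ) : k) -
          ((certCount (fun n => p₂.eval n) L₂ n e : ℕ) : k)) *
        ∏ t : Fin n, (if e t then X t else 1)) := by
  have h := (isVNPFamily_certCountGen (k := k) hL₁ p₁).sub (isVNPFamily_certCountGen (k := k) hL₂ p₂)
  have key : (fun n => (∑ e : Fin n → Bool,
      C ((certCount (fun n => p₁.eval n) L₁ n e : ℕ) : k) * ∏ t : Fin n, (if e t then X t else 1)) -
      ∑ e : Fin n → Bool,
        C ((certCount (fun n => p₂.eval n) L₂ n e : ℕ) : k) * ∏ t : Fin n, (if e t then X t else 1)) =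
      fun n => ∑ e : Fin n → Bool,
        C (((certCount (fun n => p₁.eval n) L₁ n e : ℕ) : k) -
            ((certCount (fun n => p₂.eval n) L₂ n e : ℕ) : k)) *
          ∏ t : Fin n, (if e t then X t else 1) := by
    funext n
    rw [← Finset.sum_sub_distrib]
    refine Finset.sum_congr rfl fun e _ => ?_
    rw [map_sub, sub_mul]
  rw [key] at h
  exact h

end Literature.Computability.AlgebraicComplexity
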